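import Literature.MathematicalPhysics.StatisticalMechanics.HcpFccLatticeSumsTail

/-!
# Certified hcp/fcc lattice sums: the symmetric second difference of a layer term

The registry coupling `J(s) = ∑_{ℤ²} [(Q₀+s)⁻ⁿ − (Q₁+s)⁻ⁿ]` converges much faster than either layer
sum because the offset layer sum is, after the point reflection `(i,j) ↦ (−i,−j)`, the AVERAGE of the
two shifts `Q₀ ± u + 1/3` (`u = i + j`), so that termwise only a symmetric second difference of
`φ(t) = (P + t)⁻ⁿ` (`P = Q₀ + s`) remains.  This file supplies the calculus-free estimates:

* exact second-order Taylor remainders of `x⁻³` and `x⁻⁶` (`inv_pow_three_taylor`: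
  `|(P+t)⁻³ − P⁻³ + 3tP⁻⁴| ≤ 7 t² P⁻⁵` for `30|t| ≤ P`; `inv_pow_six_taylor`: constant `46` for
  `25|t| ≤ 2P`), proved from the polynomial identities by sign bookkeeping;
* `symm_second_diff_bound`: `|P⁻ⁿ − ½φ(1/3+u) − ½φ(1/3−u)| ≤ (n/3) P⁻ⁿ⁻¹ + c (u² + 1/9) P⁻ⁿ⁻²`
  (the first-order terms average to `−(n/3)P⁻ⁿ⁻¹` exactly);
* the lattice versions `layer_sd_bound_three/six` (`|sd| ≤ (207/20)(Q₀+s)⁻⁴` resp.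
  `(317/5)(Q₀+s)⁻⁷`, using `(i+j)² ≤ (4/3) Q₀`), and where their hypotheses hold: outside `box 40`
  (resp. `box 20`) for every `s ≥ 0`, and everywhere once `s ≥ 320` (resp. `s ≥ 100`).  [folklore]
-/

noncomputable section

namespace Literature.MathematicalPhysics.StatisticalMechanics.StackingSums

open Finset

/-! ## Second-order Taylor remainders of `x ↦ x⁻³` and `x ↦ x⁻⁶` (exact algebra) -/

/-- **Remainder bound for `x⁻³`**: for `P > 0` and `30|t| ≤ P`,
`|(P+t)⁻³ − P⁻³ + 3t P⁻⁴| ≤ 7 t² P⁻⁵` (exact identity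
`(P+t)⁻³ − P⁻³ + 3tP⁻⁴ = t²(6P² + 8Pt + 3t²)/(P⁴(P+t)³)`). [folklore] -/
theorem inv_pow_three_taylor {P t : ℝ} (hP : 0 < P) (ht : 30 * |t| ≤ P) :
    |((P + t)⁻¹) ^ 3 - (P⁻¹) ^ 3 + 3 * t * (P⁻¹) ^ 4| ≤ 7 * t ^ 2 * (P⁻¹) ^ 5 := by
  have htP : |t| ≤ P / 30 := by linarith
  have ht1 : -(P / 30) ≤ t := by linarith [neg_abs_le t]
  have ht2 : t ≤ P / 30 := le_trans (le_abs_self t) htP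
  have hPt : 0 < P + t := by linarith
  have key : ((P + t)⁻¹) ^ 3 - (P⁻¹) ^ 3 + 3 * t * (P⁻¹) ^ 4 =
      t ^ 2 * (6 * P ^ 2 + 8 * P * t + 3 * t ^ 2) / (P ^ 4 * (P + t) ^ 3) := by
    field_simp
    ring
  have hden : 0 < P ^ 4 * (P + t) ^ 3 := by positivity
  have hrhs : 7 * t ^ 2 * (P⁻¹) ^ 5 = 7 * t ^ 2 / P ^ 5 := by rw [inv_pow, div_eq_mul_inv]
  rw [key, hrhs, abs_le]
  constructor
  · -- lower: X + 7t²/P⁵ = t² P⁴ H₃ /(P⁵ D) ≥ 0, H₃ = 13P³ + 29P²t + 24Pt² + 7t³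
    have hH : 0 ≤ 13 * P ^ 3 + 29 * P ^ 2 * t + 24 * P * t ^ 2 + 7 * t ^ 3 := by
      have h1 : 0 ≤ 13 * P + 29 * t := by linarith
      have h2 : 0 ≤ 24 * P + 7 * t := by linarith
      nlinarith [mul_nonneg (sq_nonneg P) h1, mul_nonneg (sq_nonneg t) h2]
    have e : t ^ 2 * (6 * P ^ 2 + 8 * P * t + 3 * t ^ 2) / (P ^ 4 * (P + t) ^ 3) + 7 * t ^ 2 / P ^ 5 =
        t ^ 2 * (13 * P ^ 3 + 29 * P ^ 2 * t + 24 * P * t ^ 2 + 7 * t ^ 3) / (P ^ 5 * (P + t) ^ 3) := by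
      field_simp
      ring
    have : 0 ≤ t ^ 2 * (13 * P ^ 3 + 29 * P ^ 2 * t + 24 * P * t ^ 2 + 7 * t ^ 3) /
        (P ^ 5 * (P + t) ^ 3) := by positivity
    linarith
  · -- upper: 7t²/P⁵ - X = t² G₃/(P⁵ D') ≥ 0, G₃ = P³ + 13P²t + 18Pt² + 7t³
    have hG : 0 ≤ P ^ 3 + 13 * P ^ 2 * t + 18 * P * t ^ 2 + 7 * t ^ 3 := by
      have h1 : 0 ≤ P + 13 * t := by linarith
      have h2 : 0 ≤ 18 * P + 7 * t := by linarith
      nlinarith [mul_nonneg (sq_nonneg P) h1, mul_nonneg (sq_nonneg t) h2]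
    have e : 7 * t ^ 2 / P ^ 5 - t ^ 2 * (6 * P ^ 2 + 8 * P * t + 3 * t ^ 2) / (P ^ 4 * (P + t) ^ 3) =
        t ^ 2 * (P ^ 3 + 13 * P ^ 2 * t + 18 * P * t ^ 2 + 7 * t ^ 3) / (P ^ 5 * (P + t) ^ 3) := by
      field_simp
      ring
    have : 0 ≤ t ^ 2 * (P ^ 3 + 13 * P ^ 2 * t + 18 * P * t ^ 2 + 7 * t ^ 3) /
        (P ^ 5 * (P + t) ^ 3) := by positivity
    linarith

/-- **Remainder bound for `x⁻⁶`**: for `P > 0` and `25|t| ≤ 2P`,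
`|(P+t)⁻⁶ − P⁻⁶ + 6t P⁻⁷| ≤ 46 t² P⁻⁸` (exact identity with numerator
`t²(21P⁵ + 70P⁴t + 105P³t² + 84P²t³ + 35Pt⁴ + 6t⁵)` over `P⁷(P+t)⁶`). [folklore] -/
theorem inv_pow_six_taylor {P t : ℝ} (hP : 0 < P) (ht : 25 * |t| ≤ 2 * P) :
    |((P + t)⁻¹) ^ 6 - (P⁻¹) ^ 6 + 6 * t * (P⁻¹) ^ 7| ≤ 46 * t ^ 2 * (P⁻¹) ^ 8 := by
  have htP : |t| ≤ 2 * P / 25 := by linarith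
  have ht1 : -(2 * P / 25) ≤ t := by linarith [neg_abs_le t]
  have ht2 : t ≤ 2 * P / 25 := le_trans (le_abs_self t) htP
  have hPt : 0 < P + t := by linarith
  have key : ((P + t)⁻¹) ^ 6 - (P⁻¹) ^ 6 + 6 * t * (P⁻¹) ^ 7 =
      t ^ 2 * (21 * P ^ 5 + 70 * P ^ 4 * t + 105 * P ^ 3 * t ^ 2 + 84 * P ^ 2 * t ^ 3 +
        35 * P * t ^ 4 + 6 * t ^ 5) / (P ^ 7 * (P + t) ^ 6) := by
    field_simp
    ring
  have hrhs : 46 * t ^ 2 * (P⁻¹) ^ 8 = 46 * t ^ 2 / P ^ 8 := by rw [inv_pow, div_eq_mul_inv]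
  rw [key, hrhs, abs_le]
  constructor
  · -- H₆ = 67P⁶ + 346P⁵t + 795P⁴t² + 1004P³t³ + 725P²t⁴ + 282Pt⁵ + 46t⁶
    have hH : 0 ≤ 67 * P ^ 6 + 346 * P ^ 5 * t + 795 * P ^ 4 * t ^ 2 + 1004 * P ^ 3 * t ^ 3 +
        725 * P ^ 2 * t ^ 4 + 282 * P * t ^ 5 + 46 * t ^ 6 := by
      have h1 : 0 ≤ 67 * P ^ 2 + 346 * P * t := by nlinarith
      have h2 : 0 ≤ 795 * P ^ 2 + 1004 * P * t := by nlinarith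
      have h3 : 0 ≤ 725 * P ^ 2 + 282 * P * t + 46 * t ^ 2 := by nlinarith
      have e : 67 * P ^ 6 + 346 * P ^ 5 * t + 795 * P ^ 4 * t ^ 2 + 1004 * P ^ 3 * t ^ 3 +
          725 * P ^ 2 * t ^ 4 + 282 * P * t ^ 5 + 46 * t ^ 6 =
          P ^ 4 * (67 * P ^ 2 + 346 * P * t) + (P ^ 2 * t ^ 2) * (795 * P ^ 2 + 1004 * P * t) +
            t ^ 4 * (725 * P ^ 2 + 282 * P * t + 46 * t ^ 2) := by ring
      rw [e]
      have : 0 ≤ P ^ 2 * t ^ 2 := by positivity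
      positivity
    have e : t ^ 2 * (21 * P ^ 5 + 70 * P ^ 4 * t + 105 * P ^ 3 * t ^ 2 + 84 * P ^ 2 * t ^ 3 +
          35 * P * t ^ 4 + 6 * t ^ 5) / (P ^ 7 * (P + t) ^ 6) + 46 * t ^ 2 / P ^ 8 =
        t ^ 2 * (67 * P ^ 6 + 346 * P ^ 5 * t + 795 * P ^ 4 * t ^ 2 + 1004 * P ^ 3 * t ^ 3 +
          725 * P ^ 2 * t ^ 4 + 282 * P * t ^ 5 + 46 * t ^ 6) / (P ^ 8 * (P + t) ^ 6) := by
      field_simp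
      ring
    have : 0 ≤ t ^ 2 * (67 * P ^ 6 + 346 * P ^ 5 * t + 795 * P ^ 4 * t ^ 2 + 1004 * P ^ 3 * t ^ 3 +
        725 * P ^ 2 * t ^ 4 + 282 * P * t ^ 5 + 46 * t ^ 6) / (P ^ 8 * (P + t) ^ 6) := by positivity
    linarith
  · -- G₆ = 25P⁶ + 206P⁵t + 585P⁴t² + 836P³t³ + 655P²t⁴ + 270Pt⁵ + 46t⁶
    have hG : 0 ≤ 25 * P ^ 6 + 206 * P ^ 5 * t + 585 * P ^ 4 * t ^ 2 + 836 * P ^ 3 * t ^ 3 +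
        655 * P ^ 2 * t ^ 4 + 270 * P * t ^ 5 + 46 * t ^ 6 := by
      have h1 : 0 ≤ 25 * P ^ 2 + 206 * P * t := by nlinarith
      have h2 : 0 ≤ 585 * P ^ 2 + 836 * P * t := by nlinarith
      have h3 : 0 ≤ 655 * P ^ 2 + 270 * P * t + 46 * t ^ 2 := by nlinarith
      have e : 25 * P ^ 6 + 206 * P ^ 5 * t + 585 * P ^ 4 * t ^ 2 + 836 * P ^ 3 * t ^ 3 +
          655 * P ^ 2 * t ^ 4 + 270 * P * t ^ 5 + 46 * t ^ 6 =
          P ^ 4 * (25 * P ^ 2 + 206 * P * t) + (P ^ 2 * t ^ 2) * (585 * P ^ 2 + 836 * P * t) +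
            t ^ 4 * (655 * P ^ 2 + 270 * P * t + 46 * t ^ 2) := by ring
      rw [e]
      have : 0 ≤ P ^ 2 * t ^ 2 := by positivity
      positivity
    have e : 46 * t ^ 2 / P ^ 8 - t ^ 2 * (21 * P ^ 5 + 70 * P ^ 4 * t + 105 * P ^ 3 * t ^ 2 +
          84 * P ^ 2 * t ^ 3 + 35 * P * t ^ 4 + 6 * t ^ 5) / (P ^ 7 * (P + t) ^ 6) =
        t ^ 2 * (25 * P ^ 6 + 206 * P ^ 5 * t + 585 * P ^ 4 * t ^ 2 + 836 * P ^ 3 * t ^ 3 +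
          655 * P ^ 2 * t ^ 4 + 270 * P * t ^ 5 + 46 * t ^ 6) / (P ^ 8 * (P + t) ^ 6) := by
      field_simp
      ring
    have : 0 ≤ t ^ 2 * (25 * P ^ 6 + 206 * P ^ 5 * t + 585 * P ^ 4 * t ^ 2 + 836 * P ^ 3 * t ^ 3 +
        655 * P ^ 2 * t ^ 4 + 270 * P * t ^ 5 + 46 * t ^ 6) / (P ^ 8 * (P + t) ^ 6) := by positivity
    linarith

/-! ## The symmetric second difference -/

/-- **Symmetric second difference**: if `φ(t) = (P+t)⁻ⁿ` has remainder
`|φ(t) − P⁻ⁿ + n t P⁻ⁿ⁻¹| ≤ c t² P⁻ⁿ⁻²` for `|t| ≤ θP`, and `|u| + 1/3 ≤ θP`, then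
`|P⁻ⁿ − ½ φ(1/3 + u) − ½ φ(1/3 − u)| ≤ (n/3) P⁻ⁿ⁻¹ + c (u² + 1/9) P⁻ⁿ⁻²`: the first-order terms
of the two shifted values average to `−(n/3) P⁻ⁿ⁻¹`, exactly. [folklore] -/
theorem symm_second_diff_bound {n : ℕ} {c θ P u : ℝ} (hP : 0 < P)
    (hrem : ∀ t : ℝ, |t| ≤ θ * P →
      |((P + t)⁻¹) ^ n - (P⁻¹) ^ n + n * t * (P⁻¹) ^ (n + 1)| ≤ c * t ^ 2 * (P⁻¹) ^ (n + 2))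
    (hu : |u| + 1 / 3 ≤ θ * P) :
    |(P⁻¹) ^ n - 1 / 2 * ((P + (1 / 3 + u))⁻¹) ^ n - 1 / 2 * ((P + (1 / 3 - u))⁻¹) ^ n| ≤
      n / 3 * (P⁻¹) ^ (n + 1) + c * (u ^ 2 + 1 / 9) * (P⁻¹) ^ (n + 2) := by
  have hp1 : |1 / 3 + u| ≤ θ * P := by
    calc |1 / 3 + u| ≤ |(1 : ℝ) / 3| + |u| := abs_add_le _ _
      _ = 1 / 3 + |u| := by rw [abs_of_pos (by norm_num : (0 : ℝ) < 1 / 3)]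
      _ ≤ θ * P := by linarith
  have hm1 : |1 / 3 - u| ≤ θ * P := by
    calc |1 / 3 - u| ≤ |(1 : ℝ) / 3| + |u| := abs_sub _ _
      _ = 1 / 3 + |u| := by rw [abs_of_pos (by norm_num : (0 : ℝ) < 1 / 3)]
      _ ≤ θ * P := by linarith
  have rp := hrem _ hp1
  have rm := hrem _ hm1
  set X := (P⁻¹) ^ (n + 2) with hX
  set Rp := ((P + (1 / 3 + u))⁻¹) ^ n - (P⁻¹) ^ n + n * (1 / 3 + u) * (P⁻¹) ^ (n + 1) with hRp
  set Rm := ((P + (1 / 3 - u))⁻¹) ^ n - (P⁻¹) ^ n + n * (1 / 3 - u) * (P⁻¹) ^ (n + 1) with hRm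
  have key : (P⁻¹) ^ n - 1 / 2 * ((P + (1 / 3 + u))⁻¹) ^ n - 1 / 2 * ((P + (1 / 3 - u))⁻¹) ^ n =
      n / 3 * (P⁻¹) ^ (n + 1) - 1 / 2 * (Rp + Rm) := by
    rw [hRp, hRm]; ring
  rw [key]
  have hsq : c * (1 / 3 + u) ^ 2 * X + c * (1 / 3 - u) ^ 2 * X = 2 * (c * (u ^ 2 + 1 / 9) * X) := by
    ring
  have hpos : 0 ≤ (n : ℝ) / 3 * (P⁻¹) ^ (n + 1) := by positivity
  calc |(n : ℝ) / 3 * (P⁻¹) ^ (n + 1) - 1 / 2 * (Rp + Rm)|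
      ≤ |(n : ℝ) / 3 * (P⁻¹) ^ (n + 1)| + |1 / 2 * (Rp + Rm)| := abs_sub _ _
    _ ≤ |(n : ℝ) / 3 * (P⁻¹) ^ (n + 1)| + 1 / 2 * (|Rp| + |Rm|) := by
        rw [abs_mul (1 / 2), abs_of_pos (by norm_num : (0 : ℝ) < 1 / 2)]
        linarith [abs_add_le Rp Rm]
    _ ≤ |(n : ℝ) / 3 * (P⁻¹) ^ (n + 1)| + c * (u ^ 2 + 1 / 9) * X := by linarith
    _ = n / 3 * (P⁻¹) ^ (n + 1) + c * (u ^ 2 + 1 / 9) * X := by rw [abs_of_nonneg hpos]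

/-! ## The lattice second difference -/

/-- `(i + j)² ≤ (4/3) Q₀`. [folklore] -/
theorem sq_add_le_stackForm_zero (i j : ℤ) : ((i : ℝ) + j) ^ 2 ≤ 4 / 3 * stackForm 0 i j := by
  rw [stackForm_zero]; nlinarith [sq_nonneg ((i : ℝ) - j)]

/-- `Q₀` is even. [folklore] -/
theorem stackForm_zero_neg (i j : ℤ) : stackForm 0 (-i) (-j) = stackForm 0 i j := by
  simp only [stackForm_zero, Int.cast_neg]; ring

/-- `Q₁(i,j) = Q₀(i,j) + (1/3 + (i + j))`. [folklore] -/
theorem stackForm_one_eq_add (i j : ℤ) : stackForm 1 i j = stackForm 0 i j + (1 / 3 + ((i : ℝ) + j)) := by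
  rw [stackForm_one, stackForm_zero]; ring

/-- `Q₁(−i,−j) = Q₀(i,j) + (1/3 − (i + j))`. [folklore] -/
theorem stackForm_one_neg (i j : ℤ) :
    stackForm 1 (-i) (-j) = stackForm 0 i j + (1 / 3 - ((i : ℝ) + j)) := by
  rw [stackForm_one, stackForm_zero]; push_cast; ring

/-- The symmetric second difference of the layer terms at `(i, j)`:
`sd = (Q₀+s)⁻ⁿ − ½ (Q₁(i,j)+s)⁻ⁿ − ½ (Q₁(−i,−j)+s)⁻ⁿ` in the variables `P = Q₀ + s`, `u = i + j`.
[folklore] -/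
theorem layer_sd_eq (n : ℕ) (s : ℝ) (i j : ℤ) :
    layerTerm 0 n s (i, j) - 1 / 2 * layerTerm 1 n s (i, j) - 1 / 2 * layerTerm 1 n s (-i, -j) =
      ((stackForm 0 i j + s)⁻¹) ^ n - 1 / 2 * ((stackForm 0 i j + s + (1 / 3 + ((i : ℝ) + j)))⁻¹) ^ n -
        1 / 2 * ((stackForm 0 i j + s + (1 / 3 - ((i : ℝ) + j)))⁻¹) ^ n := by
  simp only [layerTerm, stackForm_one_eq_add, stackForm_zero_neg, Int.cast_neg]
  ring

/-- **Termwise bound, `n = 3`**: if `|i + j| + 1/3 ≤ (Q₀ + s)/30` and `Q₀ + s ≥ 100` then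
`|sd| ≤ (207/20) · (Q₀ + s)⁻⁴` (`1 + 7·(4/3 + 1/900) = 9307/900 ≤ 207/20`). [folklore] -/
theorem layer_sd_bound_three {s : ℝ} (hs : 0 ≤ s) {i j : ℤ}
    (hθ : |(i : ℝ) + j| + 1 / 3 ≤ 1 / 30 * (stackForm 0 i j + s)) (hP : 100 ≤ stackForm 0 i j + s) :
    |layerTerm 0 3 s (i, j) - 1 / 2 * layerTerm 1 3 s (i, j) - 1 / 2 * layerTerm 1 3 s (-i, -j)| ≤
      207 / 20 * layerTerm 0 4 s (i, j) := by
  set P := stackForm 0 i j + s with hPdef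
  set u := (i : ℝ) + j with hudef
  have hP0 : 0 < P := by linarith
  have hrem : ∀ t : ℝ, |t| ≤ 1 / 30 * P →
      |((P + t)⁻¹) ^ 3 - (P⁻¹) ^ 3 + (3 : ℕ) * t * (P⁻¹) ^ (3 + 1)| ≤ 7 * t ^ 2 * (P⁻¹) ^ (3 + 2) := by
    intro t ht
    have := inv_pow_three_taylor hP0 (t := t) (by linarith)
    norm_num at this ⊢
    exact this
  have h := symm_second_diff_bound hP0 hrem hθ
  rw [layer_sd_eq]
  refine h.trans ?_
  have hu2 : u ^ 2 ≤ 4 / 3 * P := by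
    have := sq_add_le_stackForm_zero i j
    have hs' : stackForm 0 i j ≤ P := by rw [hPdef]; linarith
    rw [hudef]; nlinarith
  have hlt : layerTerm 0 4 s (i, j) = (P⁻¹) ^ 4 := rfl
  rw [hlt]
  have hX : (P⁻¹) ^ (3 + 2) = (P⁻¹) ^ 4 * P⁻¹ := by ring
  have hX1 : (P⁻¹) ^ (3 + 1) = (P⁻¹) ^ 4 := by norm_num
  rw [hX, hX1]
  have h4 : 0 < (P⁻¹) ^ 4 := by positivity
  have hkey : (u ^ 2 + 1 / 9) * P⁻¹ ≤ 1201 / 900 := by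
    rw [← div_eq_mul_inv, div_le_iff₀ hP0]; nlinarith
  push_cast
  nlinarith [mul_le_mul_of_nonneg_left hkey (by positivity : (0:ℝ) ≤ 7 * (P⁻¹) ^ 4)]

/-- **Termwise bound, `n = 6`**: if `|i + j| + 1/3 ≤ (2/25)(Q₀ + s)` and `Q₀ + s ≥ 100` then
`|sd| ≤ (317/5) · (Q₀ + s)⁻⁷` (`2 + 46·(4/3 + 1/900) ≤ 317/5`). [folklore] -/
theorem layer_sd_bound_six {s : ℝ} (hs : 0 ≤ s) {i j : ℤ}
    (hθ : |(i : ℝ) + j| + 1 / 3 ≤ 2 / 25 * (stackForm 0 i j + s)) (hP : 100 ≤ stackForm 0 i j + s) :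
    |layerTerm 0 6 s (i, j) - 1 / 2 * layerTerm 1 6 s (i, j) - 1 / 2 * layerTerm 1 6 s (-i, -j)| ≤
      317 / 5 * layerTerm 0 7 s (i, j) := by
  set P := stackForm 0 i j + s with hPdef
  set u := (i : ℝ) + j with hudef
  have hP0 : 0 < P := by linarith
  have hrem : ∀ t : ℝ, |t| ≤ 2 / 25 * P →
      |((P + t)⁻¹) ^ 6 - (P⁻¹) ^ 6 + (6 : ℕ) * t * (P⁻¹) ^ (6 + 1)| ≤ 46 * t ^ 2 * (P⁻¹) ^ (6 + 2) := by
    intro t ht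
    have := inv_pow_six_taylor hP0 (t := t) (by linarith)
    norm_num at this ⊢
    exact this
  have h := symm_second_diff_bound hP0 hrem hθ
  rw [layer_sd_eq]
  refine h.trans ?_
  have hu2 : u ^ 2 ≤ 4 / 3 * P := by
    have := sq_add_le_stackForm_zero i j
    have hs' : stackForm 0 i j ≤ P := by rw [hPdef]; linarith
    rw [hudef]; nlinarith
  have hlt : layerTerm 0 7 s (i, j) = (P⁻¹) ^ 7 := rfl
  rw [hlt]
  have hX : (P⁻¹) ^ (6 + 2) = (P⁻¹) ^ 7 * P⁻¹ := by ring
  have hX1 : (P⁻¹) ^ (6 + 1) = (P⁻¹) ^ 7 := by norm_num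
  rw [hX, hX1]
  have h7 : 0 < (P⁻¹) ^ 7 := by positivity
  have hkey : (u ^ 2 + 1 / 9) * P⁻¹ ≤ 1201 / 900 := by
    rw [← div_eq_mul_inv, div_le_iff₀ hP0]; nlinarith
  push_cast
  nlinarith [mul_le_mul_of_nonneg_left hkey (by positivity : (0:ℝ) ≤ 46 * (P⁻¹) ^ 7)]

/-! ## Where the hypotheses hold -/

/-- From `u² ≤ v²`-type information to the linear condition. [folklore] -/
theorem abs_add_third_le_of_sq {u P θ : ℝ} (hu : u ^ 2 ≤ (θ * P - 1 / 3) ^ 2) (h0 : 1 / 3 ≤ θ * P) :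
    |u| + 1 / 3 ≤ θ * P := by
  have h := abs_le_of_sq_le_sq' hu (by linarith)
  have hb : |u| ≤ θ * P - 1 / 3 := abs_le.2 ⟨by linarith [h.1], h.2⟩
  linarith

/-- **In-plane region, `n = 3`**: outside `box R` with `R ≥ 40`, for `s ≥ 0`:
`|i + j| + 1/3 ≤ (Q₀ + s)/30` and `Q₀ + s ≥ 100` (`Q₀ ≥ (3/4)·41² ≥ 1220`, and
`(4/3)Q ≤ (Q/30 − 1/3)²` for `Q ≥ 1220`). [folklore] -/
theorem inplane_hyp_three {s : ℝ} (hs : 0 ≤ s) {R : ℕ} (hR : 40 ≤ R) {i j : ℤ} (h : (i, j) ∉ box R) :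
    |(i : ℝ) + j| + 1 / 3 ≤ 1 / 30 * (stackForm 0 i j + s) ∧ 100 ≤ stackForm 0 i j + s := by
  rw [not_mem_box] at h
  have hm : ((R + 1 : ℕ) : ℤ) ≤ |i| ∨ ((R + 1 : ℕ) : ℤ) ≤ |j| := by push_cast; exact h
  have hQ := stackForm_zero_shell (R + 1) i j hm
  have hR' : (41 : ℝ) ≤ ((R + 1 : ℕ) : ℝ) := by exact_mod_cast (show 41 ≤ R + 1 by omega)
  have hQ1220 : 1220 ≤ stackForm 0 i j := by nlinarith
  have hu2 := sq_add_le_stackForm_zero i j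
  refine ⟨abs_add_third_le_of_sq ?_ (by linarith), by linarith⟩
  nlinarith

/-- **Layer region, `n = 3`**: for `s ≥ 320` and every `(i, j)`:
`|i + j| + 1/3 ≤ (Q₀ + s)/30` and `Q₀ + s ≥ 100`. [folklore] -/
theorem layer_hyp_three {s : ℝ} (hs : 320 ≤ s) (i j : ℤ) :
    |(i : ℝ) + j| + 1 / 3 ≤ 1 / 30 * (stackForm 0 i j + s) ∧ 100 ≤ stackForm 0 i j + s := by
  have hQ := stackForm_zero_nonneg i j
  have hu2 := sq_add_le_stackForm_zero i j
  refine ⟨abs_add_third_le_of_sq ?_ (by linarith), by linarith⟩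
  nlinarith [sq_nonneg (stackForm 0 i j - 290)]

/-- **In-plane region, `n = 6`**: outside `box R` with `R ≥ 20`, for `s ≥ 0`:
`|i + j| + 1/3 ≤ (2/25)(Q₀ + s)` and `Q₀ + s ≥ 100` (`Q₀ ≥ (3/4)·21² ≥ 330`). [folklore] -/
theorem inplane_hyp_six {s : ℝ} (hs : 0 ≤ s) {R : ℕ} (hR : 20 ≤ R) {i j : ℤ} (h : (i, j) ∉ box R) :
    |(i : ℝ) + j| + 1 / 3 ≤ 2 / 25 * (stackForm 0 i j + s) ∧ 100 ≤ stackForm 0 i j + s := by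
  rw [not_mem_box] at h
  have hm : ((R + 1 : ℕ) : ℤ) ≤ |i| ∨ ((R + 1 : ℕ) : ℤ) ≤ |j| := by push_cast; exact h
  have hQ := stackForm_zero_shell (R + 1) i j hm
  have hR' : (21 : ℝ) ≤ ((R + 1 : ℕ) : ℝ) := by exact_mod_cast (show 21 ≤ R + 1 by omega)
  have hQ330 : 330 ≤ stackForm 0 i j := by nlinarith
  have hu2 := sq_add_le_stackForm_zero i j
  refine ⟨abs_add_third_le_of_sq ?_ (by linarith), by linarith⟩
  nlinarith

/-- **Layer region, `n = 6`**: for `s ≥ 100` and every `(i, j)`: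
`|i + j| + 1/3 ≤ (2/25)(Q₀ + s)` and `Q₀ + s ≥ 100`. [folklore] -/
theorem layer_hyp_six {s : ℝ} (hs : 100 ≤ s) (i j : ℤ) :
    |(i : ℝ) + j| + 1 / 3 ≤ 2 / 25 * (stackForm 0 i j + s) ∧ 100 ≤ stackForm 0 i j + s := by
  have hQ := stackForm_zero_nonneg i j
  have hu2 := sq_add_le_stackForm_zero i j
  refine ⟨abs_add_third_le_of_sq ?_ (by linarith), by linarith⟩
  nlinarith [sq_nonneg (stackForm 0 i j - 100)]

end Literature.MathematicalPhysics.StatisticalMechanics.StackingSums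

end
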